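import Summits.CriticalPhenomena.SAWScalingLimit.Theorems.SAWDefectDecoherenceBoundaryClosureRInnerPolygonsBoundaryWalk
import Literature.Probability.RandomPlanarGeometry.PolygonalDomains
import HarnessLib

/-!
# Crux `BoundaryClosureR` (stmt-CriticalPhenomena-14004), line `polygon-parity-squeeze`,
# stub `stub_innerPolygons` (IP): the boundary cycle of a pinch-free finite set of triangles of
# `𝕋` is a SIMPLE CLOSED ZIGZAG POLYGON

Landing target:
`Summits/CriticalPhenomena/SAWScalingLimit/Theorems/SAWDefectDecoherenceBoundaryClosureRInnerPolygonsBoundaryPolygon.lean`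
(`--supports stmt-CriticalPhenomena-14004`; building block of the registered stub `stub_innerPolygons`).

Sequel of `…InnerPolygonsBoundaryWalk.lean` (vertex-simple boundary walk `bwalk K d₀` of a
pinch-free triangle set `K`).  Here the walk is embedded at origin `o` and mesh `h`:

* `bverts K o h d₀ P` — the vertex list `o + h·triEmbed (bwalk K d₀ t).1`, `t < P`, of one period;
* `eq_or_reverse_of_halfEdge_eq` — two half-open unit edges of `𝕋` meet only if they share their
  source or are reverse to each other (from `TriLatticeSegments.unitEdge_inter`);
* `not_isBdDart_reverse` — a boundary edge is never traversed backwards;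
* **`isSimpleClosedPolygon_bverts` / `boundaryPolygon_isSimpleClosed`** — for a minimal period the
  vertex list spans an `IsSimpleClosedPolygon` (`RandomPlanarGeometry/PolygonalDomains.lean`), hence
  bounds a polygonal Jordan domain `polygonDomain` all of whose sides are in the three zigzag
  directions `0°, 60°, 120°` of `ExactPolygonFamily` (the edges are `h·ζ^k`).

Sources: folklore; the square-lattice template is `DiscreteFaceBoundary.isSimpleClosedPolygon_bverts`.
No proposition is defined and no named fact is introduced.
-/

noncomputable section

open scoped Classical
open Literature.Probability.LatticeModels
open Literature.Probability.Percolation (triDir)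
open Literature.Probability.RandomPlanarGeometry

namespace Summit.CriticalPhenomena.SAWScalingLimit.Theorems.PolygonParitySqueeze.BoundaryWalk

variable {K : Finset HexVertex}

/-- The embedded vertex list of one period, at mesh `h` and origin `o`. [folklore] -/
def bverts (K : Finset HexVertex) (o : ℂ) (h : ℝ) (d₀ : Site 2 × Fin 6) (P : ℕ) : List ℂ :=
  (List.range P).map fun t => o + (h : ℂ) * triEmbed (bwalk K d₀ t).1

/-- Length of the vertex list. [folklore] -/
@[simp] theorem length_bverts (o : ℂ) (h : ℝ) (d₀ : Site 2 × Fin 6) (P : ℕ) :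
    (bverts K o h d₀ P).length = P := by simp [bverts]

/-- The vertices of the list. [folklore] -/
theorem getElem_bverts (o : ℂ) (h : ℝ) (d₀ : Site 2 × Fin 6) (P : ℕ) {t : ℕ}
    (ht : t < (bverts K o h d₀ P).length) :
    (bverts K o h d₀ P)[t] = o + (h : ℂ) * triEmbed (bwalk K d₀ t).1 := by
  simp [bverts]

/-- Periodicity of the walk, iterated. [folklore] -/
theorem bwalk_add_period {d₀ : Site 2 × Fin 6} {P : ℕ} (hPd : bwalk K d₀ P = d₀) (n : ℕ) :
    bwalk K d₀ (n + P) = bwalk K d₀ n := by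
  unfold bwalk at hPd ⊢
  rw [Function.iterate_add_apply, hPd]

/-- The walk only depends on the index modulo the period. [folklore] -/
theorem bwalk_mod_period {d₀ : Site 2 × Fin 6} {P : ℕ} (hPd : bwalk K d₀ P = d₀) (n : ℕ) :
    bwalk K d₀ (n % P) = bwalk K d₀ n := by
  conv_rhs => rw [← Nat.mod_add_div n P]
  generalize n / P = m
  induction m with
  | zero => simp
  | succ m ih => rw [Nat.mul_succ, ← Nat.add_assoc, bwalk_add_period hPd, ih]

/-- The source of the next dart is the head of the current one. [folklore] -/
theorem bwalk_fst_succ {d₀ : Site 2 × Fin 6} (h₀ : d₀ ∈ bdDarts K) (n : ℕ) :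
    (bwalk K d₀ (n + 1)).1 = (bwalk K d₀ n).1 + triDir (bwalk K d₀ n).2 := by
  rw [bwalk_succ]
  exact (isBdDart_bsucc (isBdDart_bwalk h₀ n)).2

/-- **A boundary edge is never traversed backwards**: the reverse of a boundary dart is not a
boundary dart (its left face is the old right face). [folklore] -/
theorem not_isBdDart_reverse {x : Site 2} {k : Fin 6} (h : (x, k) ∈ bdDarts K) :
    (x + triDir k, k + 3) ∉ bdDarts K := by
  intro h'
  have := (mem_bdDarts.1 h').1
  simp only at this
  rw [(faceL_head x k).2] at this
  exact (mem_bdDarts.1 h).2 this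

/-- `triEmbed (triDir k) ≠ 0`. [folklore] -/
theorem triEmbed_triDir_ne_zero (k : Fin 6) : triEmbed (triDir k) ≠ 0 := by
  intro h
  rw [← triEmbed_zero] at h
  exact Literature.Probability.Percolation.triDir_ne_zero k (Literature.Probability.Percolation.triEmbed_injective h)

/-- A half-open lattice edge point lies on the closed edge. [folklore] -/
theorem mem_segment_of_param {v : Site 2} {k : Fin 6} {θ : ℝ} (hθ : θ ∈ Set.Ico (0 : ℝ) 1) :
    triEmbed v + (θ : ℂ) * triEmbed (triDir k) ∈ segment ℝ (triEmbed v) (triEmbed (v + triDir k)) := by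
  rw [segment_eq_image']
  refine ⟨θ, ⟨hθ.1, hθ.2.le⟩, ?_⟩
  simp only [triEmbed_add, add_sub_cancel_left, Complex.real_smul]

/-- **Two half-open unit edges of `𝕋` meet only if they share their source or are reverse to each
other** (from `TriLatticeSegments.unitEdge_inter`). [folklore] -/
theorem eq_or_reverse_of_halfEdge_eq {v v' : Site 2} {k k' : Fin 6} {θ θ' : ℝ}
    (hθ : θ ∈ Set.Ico (0 : ℝ) 1) (hθ' : θ' ∈ Set.Ico (0 : ℝ) 1)
    (h : triEmbed v + (θ : ℂ) * triEmbed (triDir k) = triEmbed v' + (θ' : ℂ) * triEmbed (triDir k')) :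
    v = v' ∨ (v' = v + triDir k ∧ k' = k + 3) := by
  have hq1 := mem_segment_of_param (v := v) (k := k) hθ
  have hq2 := mem_segment_of_param (v := v') (k := k') hθ'
  rw [← h] at hq2
  -- an interior parameter never reaches the far endpoint
  have far : ∀ {w : Site 2} {j : Fin 6} {t : ℝ}, t ∈ Set.Ico (0 : ℝ) 1 →
      triEmbed w + (t : ℂ) * triEmbed (triDir j) ≠ triEmbed (w + triDir j) := by
    intro w j t ht heq
    rw [triEmbed_add] at heq
    have h1 : ((t : ℂ) - 1) * triEmbed (triDir j) = 0 := by linear_combination heq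
    rcases mul_eq_zero.1 h1 with h2 | h2
    · have : (t : ℂ) = 1 := by linear_combination h2
      have : t = 1 := by exact_mod_cast this
      linarith [ht.2]
    · exact triEmbed_triDir_ne_zero j h2
  rcases Literature.Probability.Percolation.unitEdge_inter hq1 hq2 with ⟨h1, h2⟩ | ⟨rfl, -⟩ | ⟨ha, hb⟩
  · left
    have e1 : triEmbed v + (θ : ℂ) * triEmbed (triDir k) = triEmbed v :=
      h1.resolve_right (far hθ)
    have e2 : triEmbed v + (θ : ℂ) * triEmbed (triDir k) = triEmbed v' := by
      refine h2.resolve_right fun h3 => far (w := v') (j := k') hθ' ?_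
      rw [← h, h3]
    exact Literature.Probability.Percolation.triEmbed_injective (e1.symm.trans e2)
  · exact Or.inl rfl
  · right
    refine ⟨hb.symm, ?_⟩
    apply Literature.Probability.Percolation.triDir_injective
    have e : triDir k' + triDir k = 0 := by
      apply add_left_cancel (a := v')
      rw [add_zero, ← add_assoc, ← ha, hb]
    rw [eq_neg_of_add_eq_zero_left e, eq_neg_of_add_eq_zero_right (triDir_add_triDir_add_three k)]

/-- A point of the half-open edge `t` of the boundary polygon, unscaled. [folklore] -/
theorem eq_of_mem_icoSegment_bverts {d₀ : Site 2 × Fin 6} (h₀ : d₀ ∈ bdDarts K) (o : ℂ) (h : ℝ)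
    {P : ℕ} (hPd : bwalk K d₀ P = d₀) {t : ℕ} (ht : t < (bverts K o h d₀ P).length) {z : ℂ}
    (hz : z ∈ icoSegment (bverts K o h d₀ P)[t]
      ((bverts K o h d₀ P)[(t + 1) % (bverts K o h d₀ P).length]'(Nat.mod_lt _ (by omega)))) :
    ∃ θ ∈ Set.Ico (0 : ℝ) 1, z = o + (h : ℂ) * (triEmbed (bwalk K d₀ t).1 +
      (θ : ℂ) * triEmbed (triDir (bwalk K d₀ t).2)) := by
  obtain ⟨θ, hθ, rfl⟩ := hz
  refine ⟨θ, hθ, ?_⟩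
  rw [getElem_bverts, getElem_bverts, length_bverts, bwalk_mod_period hPd, bwalk_fst_succ h₀,
    triEmbed_add, AffineMap.lineMap_apply_module']
  simp only [Complex.real_smul]
  ring

/-- **The boundary cycle is a simple closed polygon** (`IsSimpleClosedPolygon` of
`PolygonalDomains.lean`): consecutive vertices differ by a mesh step; two half-open edges meeting
would share their source (excluded by vertex-simplicity `bwalk_fst_injOn`) or be reverse to each
other (a boundary edge is never traversed backwards, `not_isBdDart_reverse`) (PROVED). [folklore] -/
theorem isSimpleClosedPolygon_bverts (hK : ∀ y : Site 2, (Finset.univ.filter fun k : Fin 6 => faceL y k ∈ K ∧ faceL y (k + 1) ∉ K).card ≤ 1) {d₀ : Site 2 × Fin 6} (h₀ : d₀ ∈ bdDarts K)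
    {P : ℕ} (hP : 0 < P) (hPd : bwalk K d₀ P = d₀)
    (hmin : ∀ m, 0 < m → m < P → bwalk K d₀ m ≠ d₀) (o : ℂ) {h : ℝ} (hh : 0 < h) :
    IsSimpleClosedPolygon (bverts K o h d₀ P) := by
  have hh0 : (h : ℂ) ≠ 0 := by exact_mod_cast hh.ne'
  refine IsSimpleClosedPolygon.of_lt (by rw [length_bverts]; exact hP) ?_ ?_
  · intro t ht heq
    rw [getElem_bverts, getElem_bverts, length_bverts, bwalk_mod_period hPd, bwalk_fst_succ h₀,
      add_right_inj] at heq
    have := Literature.Probability.Percolation.triEmbed_injective (mul_left_cancel₀ hh0 heq)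
    exact Literature.Probability.Percolation.triDir_ne_zero _
      (add_left_cancel (a := (bwalk K d₀ t).1) (by rw [add_zero]; exact this.symm))
  · intro s t hs ht hst
    rw [Set.disjoint_left]
    intro z hzs hzt
    obtain ⟨θ, hθ, hz1⟩ := eq_of_mem_icoSegment_bverts h₀ o h hPd hs hzs
    obtain ⟨θ', hθ', hz2⟩ := eq_of_mem_icoSegment_bverts h₀ o h hPd ht hzt
    rw [hz1, add_right_inj] at hz2
    have heq := mul_left_cancel₀ hh0 hz2
    rw [length_bverts] at hs ht
    rcases eq_or_reverse_of_halfEdge_eq hθ hθ' heq with hv | ⟨hv, hk⟩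
    · have := bwalk_fst_injOn hK h₀ hmin hs ht hv
      omega
    · have hrev := not_isBdDart_reverse (isBdDart_bwalk h₀ s)
      have e : bwalk K d₀ t = ((bwalk K d₀ s).1 + triDir (bwalk K d₀ s).2,
          (bwalk K d₀ s).2 + 3) := Prod.ext hv hk
      have hbt := isBdDart_bwalk h₀ t
      rw [e] at hbt
      exact hrev hbt

/-- **The boundary polygon is a simple closed polygon** (registered form, sub-goal of
`stub_innerPolygons`). [folklore] -/
theorem boundaryPolygon_isSimpleClosed : ∀ (K : Finset HexVertex), (∀ y : Site 2, (Finset.univ.filter fun k : Fin 6 => faceL y k ∈ K ∧ faceL y (k + 1) ∉ K).card ≤ 1) → ∀ (d₀ : Site 2 × Fin 6), d₀ ∈ bdDarts K → ∀ (P : ℕ), 0 < P → bwalk K d₀ P = d₀ → (∀ m : ℕ, 0 < m → m < P → bwalk K d₀ m ≠ d₀) → ∀ (o : ℂ) (h : ℝ), 0 < h → IsSimpleClosedPolygon (bverts K o h d₀ P) := by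
  intro K hK d₀ h₀ P hP hPd hmin o h hh
  exact isSimpleClosedPolygon_bverts hK h₀ hP hPd hmin o hh

end Summit.CriticalPhenomena.SAWScalingLimit.Theorems.PolygonParitySqueeze.BoundaryWalk

end
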